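import Mathlib
import Summits.Ventures.PercRepro2.PMK5Deg5LocusWit

/-!
# THE FIVE CLASSES ARE CLOSED UNDER EDGE DELETION, AND THE TWO COVERINGS — PART A
(blind cell PercRepro2, mine-2 g32; the chunks `4 … 7` of `coverAll`, its assembly and the two coverings are in
`PMK5Deg5LocusCoverB.lean`)

`conn` is monotone in the configuration (`conn_iff` + `conn_mono`: a connection survives the opening of edges),
so every clause of the five classes — a non-connection in `K₆(M)` with some marks' edges removed — survives the
deletion of edges: **`fiveClass15_mono`**, the five classes form a DOWN-SET of edge sets.  With it the two
coverings cost no connectivity at all: **`coverAll`** (eight `decide +kernel` over `4096` masks each, bitmask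
inclusions `a &&& b = a` only) says that every edge set contains one of the fifty witness supports `WW` or lies inside one of the fourteen
maximal faces `MX`; `fiveClass_WW` (the fifty supports are non-degenerate) and `fiveClass_MX` (the fourteen faces
are degenerate) then split it: **`coverPos`** — a non-degenerate edge set contains a witness support (it cannot lie
in a degenerate face, by the down-set property) — and **`coverZero`** — a degenerate edge set lies inside a maximal
face (it cannot contain a non-degenerate support).  Standard axioms.
-/

namespace Summit.Ventures.PercRepro2

namespace Deg5

namespace Locus

/-! ## Monotonicity of the bitmask connectivity and of the five classes -/

/-- `conn` is monotone in the configuration. -/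
lemma conn_mono15 {ω ω' : Fin 15 → Bool} (h : ∀ e, ω e = true → ω' e = true) {u v : ℕ} (hu : u < 6)
    (hv : v < 6) (hc : conn ω u v = true) : conn ω' u v = true := by
  rw [conn_iff' ω hu hv] at hc
  rw [conn_iff' ω' hu hv]
  exact conn_mono (fun e => Bool.le_iff_imp.2 (h e)) hc

/-- A non-connection survives the deletion of edges. -/
lemma nconn_mono15 {ω ω' : Fin 15 → Bool} (h : ∀ e, ω e = true → ω' e = true) {u v : ℕ} (hu : u < 6)
    (hv : v < 6) (hc : conn ω' u v = false) : conn ω u v = false := by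
  rcases Bool.eq_false_or_eq_true (conn ω u v) with h' | h'
  · rw [conn_mono15 h hu hv h'] at hc
    exact absurd hc (by decide)
  · exact h'

/-- `cfg15` is monotone in the edge set. -/
lemma cfg15_mono {M M' : ℕ} (h : ∀ e : Fin 15, M.testBit e = true → M'.testBit e = true) :
    ∀ e, cfg15 M e = true → cfg15 M' e = true := h

/-- `cfgAvoid15` is monotone in the edge set. -/
lemma cfgAvoid15_mono {M M' : ℕ} (h : ∀ e : Fin 15, M.testBit e = true → M'.testBit e = true) (r : ℕ) :
    ∀ e, cfgAvoid15 M r e = true → cfgAvoid15 M' r e = true := by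
  intro e
  unfold cfgAvoid15
  simp only [Bool.and_eq_true]
  rintro ⟨⟨h1, h2⟩, h3⟩
  exact ⟨⟨h e h1, h2⟩, h3⟩

/-- `cfgAvoid2_15` is monotone in the edge set. -/
lemma cfgAvoid2_15_mono {M M' : ℕ} (h : ∀ e : Fin 15, M.testBit e = true → M'.testBit e = true) (r s : ℕ) :
    ∀ e, cfgAvoid2_15 M r s e = true → cfgAvoid2_15 M' r s e = true := by
  intro e
  unfold cfgAvoid2_15
  simp only [Bool.and_eq_true]
  rintro ⟨⟨⟨⟨h1, h2⟩, h3⟩, h4⟩, h5⟩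
  exact ⟨⟨⟨⟨h e h1, h2⟩, h3⟩, h4⟩, h5⟩

/-- **The five classes are closed under edge deletion**: if `M ⊆ M'` and `K₆(M')` is in one of the five classes,
so is `K₆(M)`. -/
theorem fiveClass15_mono {M M' : ℕ} (h : ∀ e : Fin 15, M.testBit e = true → M'.testBit e = true)
    (hM' : FiveClass15 M' = true) : FiveClass15 M = true := by
  unfold FiveClass15 Trivial15 Sep2_15 Sep3_15 Sep3'_15 A3O15 OneRoot15 OneRoot'15 at hM' ⊢
  simp only [Bool.or_eq_true, Bool.and_eq_true, Bool.not_eq_true'] at hM' ⊢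
  have c := fun (x y : ℕ) (hx : x < 6) (hy : y < 6) => nconn_mono15 (cfg15_mono h) hx hy (u := x) (v := y)
  have a := fun (r x y : ℕ) (hx : x < 6) (hy : y < 6) =>
    nconn_mono15 (cfgAvoid15_mono h r) hx hy (u := x) (v := y)
  have a2 := fun (r s x y : ℕ) (hx : x < 6) (hy : y < 6) =>
    nconn_mono15 (cfgAvoid2_15_mono h r s) hx hy (u := x) (v := y)
  rcases hM' with ((((((h1 | h1) | h2) | h3) | h4) | h5) | h6) | h7
  · exact Or.inl (Or.inl (Or.inl (Or.inl (Or.inl (Or.inl (Or.inl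
      ⟨c 0 1 (by norm_num) (by norm_num) h1.1, c 0 2 (by norm_num) (by norm_num) h1.2⟩))))))
  · exact Or.inl (Or.inl (Or.inl (Or.inl (Or.inl (Or.inl (Or.inr
      ⟨c 4 1 (by norm_num) (by norm_num) h1.1, c 4 2 (by norm_num) (by norm_num) h1.2⟩))))))
  · exact Or.inl (Or.inl (Or.inl (Or.inl (Or.inl (Or.inr (a2 1 2 0 4 (by norm_num) (by norm_num) h2))))))
  · exact Or.inl (Or.inl (Or.inl (Or.inl (Or.inr
      ⟨a2 1 5 0 2 (by norm_num) (by norm_num) h3.1, a2 1 5 0 4 (by norm_num) (by norm_num) h3.2⟩))))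
  · exact Or.inl (Or.inl (Or.inl (Or.inr
      ⟨a2 2 5 0 1 (by norm_num) (by norm_num) h4.1, a2 2 5 0 4 (by norm_num) (by norm_num) h4.2⟩)))
  · exact Or.inl (Or.inl (Or.inr
      ⟨a 5 0 1 (by norm_num) (by norm_num) h5.1, a 5 0 2 (by norm_num) (by norm_num) h5.2⟩))
  · exact Or.inl (Or.inr ⟨⟨a 2 1 0 (by norm_num) (by norm_num) h6.1.1,
      a 2 1 4 (by norm_num) (by norm_num) h6.1.2⟩, a 2 1 5 (by norm_num) (by norm_num) h6.2⟩)
  · exact Or.inr ⟨⟨a 1 2 0 (by norm_num) (by norm_num) h7.1.1,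
      a 1 2 4 (by norm_num) (by norm_num) h7.1.2⟩, a 1 2 5 (by norm_num) (by norm_num) h7.2⟩

/-! ## The two coverings -/

set_option maxHeartbeats 0 in
set_option maxRecDepth 100000 in
/-- The fifty witness supports are non-degenerate. -/
theorem fiveClass_WW : ∀ i : Fin 50, FiveClass15 (WW i) = false := by
  decide +kernel

set_option maxHeartbeats 0 in
set_option maxRecDepth 100000 in
/-- The fourteen maximal faces are degenerate. -/
theorem fiveClass_MX : ∀ j : Fin 14, FiveClass15 (MX j) = true := by
  decide +kernel

/-- A bitmask inclusion `a ⊆ b` (`a &&& b = a`) read bitwise. -/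
lemma testBit_of_land {a b : ℕ} (h : a &&& b = a) (e : Fin 15) (he : a.testBit e = true) :
    b.testBit e = true := by
  have h' := congrArg (fun n => n.testBit e) h
  simp only [Nat.testBit_land, he, Bool.true_and] at h'
  exact h'

set_option maxHeartbeats 0 in
set_option maxRecDepth 100000 in
/-- The covering on the masks `0 … 4095`. -/
theorem coverAll0 : ∀ m : Fin 4096,
    (∃ i : Fin 50, WW i &&& ((m : ℕ) + 0) = WW i) ∨
      (∃ j : Fin 14, ((m : ℕ) + 0) &&& MX j = (m : ℕ) + 0) := by
  decide +kernel

set_option maxHeartbeats 0 in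
set_option maxRecDepth 100000 in
/-- The covering on the masks `4096 … 8191`. -/
theorem coverAll1 : ∀ m : Fin 4096,
    (∃ i : Fin 50, WW i &&& ((m : ℕ) + 4096) = WW i) ∨
      (∃ j : Fin 14, ((m : ℕ) + 4096) &&& MX j = (m : ℕ) + 4096) := by
  decide +kernel

set_option maxHeartbeats 0 in
set_option maxRecDepth 100000 in
/-- The covering on the masks `8192 … 12287`. -/
theorem coverAll2 : ∀ m : Fin 4096,
    (∃ i : Fin 50, WW i &&& ((m : ℕ) + 8192) = WW i) ∨
      (∃ j : Fin 14, ((m : ℕ) + 8192) &&& MX j = (m : ℕ) + 8192) := by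
  decide +kernel

set_option maxHeartbeats 0 in
set_option maxRecDepth 100000 in
/-- The covering on the masks `12288 … 16383`. -/
theorem coverAll3 : ∀ m : Fin 4096,
    (∃ i : Fin 50, WW i &&& ((m : ℕ) + 12288) = WW i) ∨
      (∃ j : Fin 14, ((m : ℕ) + 12288) &&& MX j = (m : ℕ) + 12288) := by
  decide +kernel

end Locus

end Deg5

end Summit.Ventures.PercRepro2
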